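import Summits.KontsevichZagierPeriods.KontsevichZagierPeriods.Theorems.FermatIsogenyBetaLinearSectorStubSectorChartAux

/-!
# `BetaLinearSector` (stmt-KontsevichZagierPeriods-3897), line `fermat-sector-transport` — stub
# `stub_sectorChart` (B1: the sector chart on the Fermat curve, analytic facts)

On the affine Fermat curve `F_N = {x^N + y^N = 1}` (`N ≥ 3`) the SECTOR CHART is
`Y(z) = exp(−iπ/(2N)) · (i(1 − z^N))^{1/N}` (principal power), so that `Φ(z) = (z, Y z) ∈ F_N`
(`Y(z)^N = exp(−iπ/2) · i · (1 − z^N) = 1 − z^N`).  We collect the analytic facts used by the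
topological sector stubs: continuity of `Y` on the star-shaped sets `S⁺ = {0 ≤ Im z^N}` and
`S⁻ = {Im u^N ≤ 0, |u^N| ≤ 1, u^N ≠ 1}` (file `…StubSectorChartAux`), the values of `Y` on the real
arc `γ_N(t) = Q^{−1/N}(1−t, t)` (`Y(γ_x) = γ_y`), on the real branch `x > 1` (`Y(1/γ_x) = ε̄ γ_y/γ_x`,
as `1 − γ_x^{−N} = −(γ_y/γ_x)^N` has argument `−π/2` after multiplication by `i`), on the rays
`arg = ±π/N` (`(ε ρ)^N = −ρ^N`), and the frontier identity `ε Y(x_f)/x_f = Y(1/x_f)` along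
`x_f(t) = (2−t)^{1/N} e^{iπt/N}` (both sides are continuous `N`-th roots of `1 − x_f^{−N} ≠ 0` on
`[0,1]` agreeing at `t = 0`, hence everywhere by connectedness).

References: B. Gross, *On the periods of abelian integrals and a formula of Chowla and Selberg*
(1978), §1 (with Rohrlich's appendix); A. Huber, G. Wüstholz, *Transcendence and Linear Relations of
1-Periods* (2022), §3.3.1.
-/

noncomputable section

open scoped BigOperators unitInterval
open MeasureTheory Set MvPolynomial
open Literature.NumberTheory.Transcendental Literature.NumberTheory.Transcendental.CurvePeriods

namespace Summit.KontsevichZagierPeriods.FermatIsogeny.BetaLinearSector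

/-! ## Values of `Y` on the real branch `x > 1` and on the rays `arg = ±π/N` -/

/-- On the real branch `x > 1`: `x > 0`, `y ≥ 0` real, `x^N + y^N = 1` ⇒ `Y(1/x) = ε̄ y/x`
(`1 − x^{−N} = −(y/x)^N`). [cite: Gross1978, §1] -/
theorem sectorChart_inv_real {N : ℕ} (hN : N ≠ 0) {x y : ℝ} (hx : 0 < x) (hy : 0 ≤ y)
    (h : x ^ N + y ^ N = 1) :
    Complex.exp (-(↑Real.pi * Complex.I / (2 * (N : ℂ)))) *
        (Complex.I * (1 - ((x : ℂ)⁻¹) ^ N)) ^ ((N : ℂ)⁻¹) =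
      Complex.exp (-(↑Real.pi * Complex.I / (N : ℂ))) * (y : ℂ) / (x : ℂ) := by
  have hx0 : (x : ℂ) ≠ 0 := Complex.ofReal_ne_zero.2 hx.ne'
  have hxN : (x : ℂ) ^ N ≠ 0 := pow_ne_zero N hx0
  have h' : (x : ℂ) ^ N + (y : ℂ) ^ N = 1 := by exact_mod_cast h
  have h1 : (1 : ℂ) - ((x : ℂ)⁻¹) ^ N = -((((y / x) ^ N : ℝ) : ℂ)) := by
    push_cast
    rw [inv_pow, div_pow]
    field_simp
    linear_combination h'
  rw [show Complex.I * (1 - ((x : ℂ)⁻¹) ^ N) = Complex.I * (-((((y / x) ^ N : ℝ) : ℂ))) by rw [h1],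
    sectorChart_root_neg hN (pow_nonneg (div_nonneg hy hx.le) N),
    Real.pow_rpow_inv_natCast (div_nonneg hy hx.le) hN, Complex.ofReal_div]
  ring

/-- `(1/x)^N` is real for real `x` (membership of `1/x` in `S⁺`). [folklore] -/
theorem sectorChart_inv_real_im {N : ℕ} (x : ℝ) : 0 ≤ ((((x : ℂ))⁻¹) ^ N).im := by
  rw [← Complex.ofReal_inv, ← Complex.ofReal_pow, Complex.ofReal_im]

/-- On the ray `arg = π/N`: `x`, `y > 0` real, `x^N + y^N = 1` ⇒ `Y(ε x/y) = 1/y`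
(`(ε x/y)^N = −(x/y)^N`, `1 + (x/y)^N = y^{−N}`) and `Im (ε x/y)^N = 0 ≥ 0`. [cite: Gross1978, §1] -/
theorem sectorChart_ray_plus {N : ℕ} (hN : N ≠ 0) {x y : ℝ} (hy : 0 < y) (h : x ^ N + y ^ N = 1) :
    Complex.exp (-(↑Real.pi * Complex.I / (2 * (N : ℂ)))) *
        (Complex.I * (1 - (Complex.exp (↑Real.pi * Complex.I / (N : ℂ)) * (x : ℂ) / (y : ℂ)) ^ N)) ^
          ((N : ℂ)⁻¹) = ((y : ℂ))⁻¹ ∧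
      0 ≤ ((Complex.exp (↑Real.pi * Complex.I / (N : ℂ)) * (x : ℂ) / (y : ℂ)) ^ N).im := by
  have hy0 : (y : ℂ) ≠ 0 := Complex.ofReal_ne_zero.2 hy.ne'
  have hyN : (y : ℂ) ^ N ≠ 0 := pow_ne_zero N hy0
  have h' : (x : ℂ) ^ N + (y : ℂ) ^ N = 1 := by exact_mod_cast h
  have hw : (Complex.exp (↑Real.pi * Complex.I / (N : ℂ)) * (x : ℂ) / (y : ℂ)) ^ N =
      (((-((x / y) ^ N)) : ℝ) : ℂ) := by
    rw [div_pow, mul_pow, sectorChart_eps_pow hN]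
    push_cast
    rw [div_pow]
    ring
  refine ⟨?_, ?_⟩
  · have h1 : (1 : ℂ) - (Complex.exp (↑Real.pi * Complex.I / (N : ℂ)) * (x : ℂ) / (y : ℂ)) ^ N =
        ((((y⁻¹) ^ N : ℝ)) : ℂ) := by
      rw [hw]
      push_cast
      rw [div_pow, inv_pow]
      field_simp
      linear_combination h'
    rw [show Complex.I * (1 - (Complex.exp (↑Real.pi * Complex.I / (N : ℂ)) * (x : ℂ) / (y : ℂ)) ^ N) =
        Complex.I * ((((y⁻¹) ^ N : ℝ)) : ℂ) by rw [h1],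
      sectorChart_root_pos hN (pow_nonneg (inv_nonneg.2 hy.le) N),
      Real.pow_rpow_inv_natCast (inv_nonneg.2 hy.le) hN, Complex.ofReal_inv]
  · rw [hw, Complex.ofReal_im]

/-- On the ray `arg = −π/N`: `x > 0`, `0 ≤ y ≤ x` real, `x^N + y^N = 1` ⇒ `Y(ε̄ y/x) = 1/x`
(`(ε̄ y/x)^N = −(y/x)^N ∈ [−1, 0]`, `1 + (y/x)^N = x^{−N}`), and `ε̄ y/x ∈ S⁻`. [cite: Gross1978, §1] -/
theorem sectorChart_ray_minus {N : ℕ} (hN : N ≠ 0) {x y : ℝ} (hx : 0 < x) (hy : 0 ≤ y) (hyx : y ≤ x)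
    (h : x ^ N + y ^ N = 1) :
    Complex.exp (-(↑Real.pi * Complex.I / (2 * (N : ℂ)))) *
        (Complex.I * (1 - (Complex.exp (-(↑Real.pi * Complex.I / (N : ℂ))) * (y : ℂ) / (x : ℂ)) ^ N)) ^
          ((N : ℂ)⁻¹) = ((x : ℂ))⁻¹ ∧
      ((Complex.exp (-(↑Real.pi * Complex.I / (N : ℂ))) * (y : ℂ) / (x : ℂ)) ^ N).im ≤ 0 ∧
      ‖(Complex.exp (-(↑Real.pi * Complex.I / (N : ℂ))) * (y : ℂ) / (x : ℂ)) ^ N‖ ≤ 1 ∧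
      (Complex.exp (-(↑Real.pi * Complex.I / (N : ℂ))) * (y : ℂ) / (x : ℂ)) ^ N ≠ 1 := by
  have hx0 : (x : ℂ) ≠ 0 := Complex.ofReal_ne_zero.2 hx.ne'
  have hxN : (x : ℂ) ^ N ≠ 0 := pow_ne_zero N hx0
  have h' : (x : ℂ) ^ N + (y : ℂ) ^ N = 1 := by exact_mod_cast h
  have hq0 : 0 ≤ (y / x) ^ N := pow_nonneg (div_nonneg hy hx.le) N
  have hq1 : (y / x) ^ N ≤ 1 := pow_le_one₀ (div_nonneg hy hx.le) ((div_le_one hx).2 hyx)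
  have hw : (Complex.exp (-(↑Real.pi * Complex.I / (N : ℂ))) * (y : ℂ) / (x : ℂ)) ^ N =
      (((-((y / x) ^ N)) : ℝ) : ℂ) := by
    rw [div_pow, mul_pow, sectorChart_epsBar_pow hN]
    push_cast
    rw [div_pow]
    ring
  refine ⟨?_, ?_, ?_, ?_⟩
  · have h1 : (1 : ℂ) - (Complex.exp (-(↑Real.pi * Complex.I / (N : ℂ))) * (y : ℂ) / (x : ℂ)) ^ N =
        ((((x⁻¹) ^ N : ℝ)) : ℂ) := by
      rw [hw]
      push_cast
      rw [div_pow, inv_pow]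
      field_simp
      linear_combination h'
    rw [show Complex.I * (1 - (Complex.exp (-(↑Real.pi * Complex.I / (N : ℂ))) * (y : ℂ) / (x : ℂ)) ^ N) =
        Complex.I * ((((x⁻¹) ^ N : ℝ)) : ℂ) by rw [h1],
      sectorChart_root_pos hN (pow_nonneg (inv_nonneg.2 hx.le) N),
      Real.pow_rpow_inv_natCast (inv_nonneg.2 hx.le) hN, Complex.ofReal_inv]
  · rw [hw, Complex.ofReal_im]
  · rw [hw, Complex.norm_real, Real.norm_eq_abs, abs_neg, abs_of_nonneg hq0]
    exact hq1
  · rw [hw]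
    intro h1
    have h2 : (-((y / x) ^ N) : ℝ) = 1 := by exact_mod_cast h1
    linarith

/-! ## The radial arc `γ_N(t) = Q^{−1/N}(1 − t, t)` -/

/-- `Q(t)^{−1/N} > 0`. [folklore] -/
theorem sectorChart_arcScale_pos {N : ℕ} (hN : 1 ≤ N) (t : ℝ) :
    0 < ((1 - t) ^ N + t ^ N) ^ (-(1:ℝ) / N) :=
  Real.rpow_pos_of_pos (fermatQ_pos hN t) _

/-- (d) the real arc: `Y(γ_x(t)) = γ_y(t)`, `γ_x(t) ∈ S⁺`, and for `t ≥ 1/2` also `γ_x(t) ∈ S⁻`.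
[cite: Gross1978, §1] -/
theorem sectorChart_arc {N : ℕ} (hN : 1 ≤ N) : ∀ t ∈ Set.Icc (0:ℝ) 1,
      Complex.exp (-(↑Real.pi * Complex.I / (2 * (N : ℂ)))) *
          (Complex.I * (1 - ((((1 - t) * ((1 - t) ^ N + t ^ N) ^ (-(1:ℝ) / N) : ℝ) : ℂ)) ^ N)) ^ ((N : ℂ)⁻¹) =
        ((t * ((1 - t) ^ N + t ^ N) ^ (-(1:ℝ) / N) : ℝ) : ℂ) ∧
      0 ≤ (((((1 - t) * ((1 - t) ^ N + t ^ N) ^ (-(1:ℝ) / N) : ℝ) : ℂ)) ^ N).im ∧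
      (1 / 2 ≤ t → (((((1 - t) * ((1 - t) ^ N + t ^ N) ^ (-(1:ℝ) / N) : ℝ) : ℂ)) ^ N).im ≤ 0 ∧
        ‖((((1 - t) * ((1 - t) ^ N + t ^ N) ^ (-(1:ℝ) / N) : ℝ) : ℂ)) ^ N‖ ≤ 1 ∧
        ((((1 - t) * ((1 - t) ^ N + t ^ N) ^ (-(1:ℝ) / N) : ℝ) : ℂ)) ^ N ≠ 1) := by
  intro t ht
  have hN0 : N ≠ 0 := by omega
  have hL := sectorChart_arcScale_pos hN t
  have hab := fermatArc_pow_add_pow hN t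
  have hx : 0 ≤ (1 - t) * ((1 - t) ^ N + t ^ N) ^ (-(1:ℝ) / N) :=
    mul_nonneg (by linarith [ht.2]) hL.le
  have hy : 0 ≤ t * ((1 - t) ^ N + t ^ N) ^ (-(1:ℝ) / N) := mul_nonneg ht.1 hL.le
  refine ⟨sectorChart_real hN0 hy hab, ?_, fun ht2 => ⟨?_, ?_, ?_⟩⟩
  · rw [← Complex.ofReal_pow, Complex.ofReal_im]
  · rw [← Complex.ofReal_pow, Complex.ofReal_im]
  · rw [← Complex.ofReal_pow, Complex.norm_real, Real.norm_of_nonneg (pow_nonneg hx N)]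
    nlinarith [pow_nonneg hy N]
  · rw [← Complex.ofReal_pow]
    intro h1
    have h2 : ((1 - t) * ((1 - t) ^ N + t ^ N) ^ (-(1:ℝ) / N)) ^ N = 1 := by exact_mod_cast h1
    have h3 : (t * ((1 - t) ^ N + t ^ N) ^ (-(1:ℝ) / N)) ^ N = 0 := by linarith
    have h4 : 0 < t * ((1 - t) ^ N + t ^ N) ^ (-(1:ℝ) / N) := mul_pos (by linarith) hL
    exact absurd h3 (pow_ne_zero N h4.ne')

/-- (e) the branch `x > 1`: `Y(1/γ_x(u)) = ε̄ γ_y(u)/γ_x(u)` for `u ∈ [0, 1/2]`, and `1/γ_x(u) ∈ S⁺`.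
[cite: Gross1978, §1] -/
theorem sectorChart_branch {N : ℕ} (hN : 1 ≤ N) : ∀ u ∈ Set.Icc (0:ℝ) (1/2),
      Complex.exp (-(↑Real.pi * Complex.I / (2 * (N : ℂ)))) *
          (Complex.I * (1 - (((((1 - u) * ((1 - u) ^ N + u ^ N) ^ (-(1:ℝ) / N) : ℝ) : ℂ))⁻¹) ^ N)) ^ ((N : ℂ)⁻¹) =
        Complex.exp (-(↑Real.pi * Complex.I / (N : ℂ))) * ((u * ((1 - u) ^ N + u ^ N) ^ (-(1:ℝ) / N) : ℝ) : ℂ) /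
          ((((1 - u) * ((1 - u) ^ N + u ^ N) ^ (-(1:ℝ) / N) : ℝ) : ℂ)) ∧
      0 ≤ (((((((1 - u) * ((1 - u) ^ N + u ^ N) ^ (-(1:ℝ) / N) : ℝ) : ℂ))⁻¹) ^ N).im) := by
  intro u hu
  have hN0 : N ≠ 0 := by omega
  have hL := sectorChart_arcScale_pos hN u
  have hab := fermatArc_pow_add_pow hN u
  have hx : 0 < (1 - u) * ((1 - u) ^ N + u ^ N) ^ (-(1:ℝ) / N) := mul_pos (by linarith [hu.2]) hL
  have hy : 0 ≤ u * ((1 - u) ^ N + u ^ N) ^ (-(1:ℝ) / N) := mul_nonneg hu.1 hL.le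
  exact ⟨sectorChart_inv_real hN0 hx hy hab, sectorChart_inv_real_im _⟩

/-- (f) the ray `arg = π/N`: `Y(ε γ_x(v)/γ_y(v)) = 1/γ_y(v)` for `v ∈ [1/2, 1]`, and `ε γ_x/γ_y ∈ S⁺`.
[cite: Gross1978, §1] -/
theorem sectorChart_rayPlus_arc {N : ℕ} (hN : 1 ≤ N) : ∀ v ∈ Set.Icc (1/2:ℝ) 1,
      Complex.exp (-(↑Real.pi * Complex.I / (2 * (N : ℂ)))) *
          (Complex.I * (1 - (Complex.exp (↑Real.pi * Complex.I / (N : ℂ)) *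
            ((((1 - v) * ((1 - v) ^ N + v ^ N) ^ (-(1:ℝ) / N) : ℝ) : ℂ)) /
            ((v * ((1 - v) ^ N + v ^ N) ^ (-(1:ℝ) / N) : ℝ) : ℂ)) ^ N)) ^ ((N : ℂ)⁻¹) =
        (((v * ((1 - v) ^ N + v ^ N) ^ (-(1:ℝ) / N) : ℝ) : ℂ))⁻¹ ∧
      0 ≤ ((Complex.exp (↑Real.pi * Complex.I / (N : ℂ)) *
            ((((1 - v) * ((1 - v) ^ N + v ^ N) ^ (-(1:ℝ) / N) : ℝ) : ℂ)) /
            ((v * ((1 - v) ^ N + v ^ N) ^ (-(1:ℝ) / N) : ℝ) : ℂ)) ^ N).im := by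
  intro v hv
  have hN0 : N ≠ 0 := by omega
  have hL := sectorChart_arcScale_pos hN v
  have hab := fermatArc_pow_add_pow hN v
  have hy : 0 < v * ((1 - v) ^ N + v ^ N) ^ (-(1:ℝ) / N) := mul_pos (by linarith [hv.1]) hL
  exact sectorChart_ray_plus hN0 hy hab

/-- (g) the ray `arg = −π/N`: `Y(ε̄ γ_y(u)/γ_x(u)) = 1/γ_x(u)` for `u ∈ [0, 1/2]`, and `ε̄ γ_y/γ_x ∈ S⁻`.
[cite: Gross1978, §1] -/
theorem sectorChart_rayMinus_arc {N : ℕ} (hN : 1 ≤ N) : ∀ u ∈ Set.Icc (0:ℝ) (1/2),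
      Complex.exp (-(↑Real.pi * Complex.I / (2 * (N : ℂ)))) *
          (Complex.I * (1 - (Complex.exp (-(↑Real.pi * Complex.I / (N : ℂ))) *
            ((u * ((1 - u) ^ N + u ^ N) ^ (-(1:ℝ) / N) : ℝ) : ℂ) /
            ((((1 - u) * ((1 - u) ^ N + u ^ N) ^ (-(1:ℝ) / N) : ℝ) : ℂ))) ^ N)) ^ ((N : ℂ)⁻¹) =
        (((((1 - u) * ((1 - u) ^ N + u ^ N) ^ (-(1:ℝ) / N) : ℝ) : ℂ)))⁻¹ ∧
      ((Complex.exp (-(↑Real.pi * Complex.I / (N : ℂ))) *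
            ((u * ((1 - u) ^ N + u ^ N) ^ (-(1:ℝ) / N) : ℝ) : ℂ) /
            ((((1 - u) * ((1 - u) ^ N + u ^ N) ^ (-(1:ℝ) / N) : ℝ) : ℂ))) ^ N).im ≤ 0 ∧
      ‖(Complex.exp (-(↑Real.pi * Complex.I / (N : ℂ))) *
            ((u * ((1 - u) ^ N + u ^ N) ^ (-(1:ℝ) / N) : ℝ) : ℂ) /
            ((((1 - u) * ((1 - u) ^ N + u ^ N) ^ (-(1:ℝ) / N) : ℝ) : ℂ))) ^ N‖ ≤ 1 ∧
      (Complex.exp (-(↑Real.pi * Complex.I / (N : ℂ))) *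
            ((u * ((1 - u) ^ N + u ^ N) ^ (-(1:ℝ) / N) : ℝ) : ℂ) /
            ((((1 - u) * ((1 - u) ^ N + u ^ N) ^ (-(1:ℝ) / N) : ℝ) : ℂ))) ^ N ≠ 1 := by
  intro u hu
  have hN0 : N ≠ 0 := by omega
  have hL := sectorChart_arcScale_pos hN u
  have hab := fermatArc_pow_add_pow hN u
  have hx : 0 < (1 - u) * ((1 - u) ^ N + u ^ N) ^ (-(1:ℝ) / N) := mul_pos (by linarith [hu.2]) hL
  have hy : 0 ≤ u * ((1 - u) ^ N + u ^ N) ^ (-(1:ℝ) / N) := mul_nonneg hu.1 hL.le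
  have hyx : u * ((1 - u) ^ N + u ^ N) ^ (-(1:ℝ) / N) ≤ (1 - u) * ((1 - u) ^ N + u ^ N) ^ (-(1:ℝ) / N) :=
    mul_le_mul_of_nonneg_right (by linarith [hu.2]) hL.le
  exact sectorChart_ray_minus hN0 hx hy hyx hab

/-! ## The frontier identity -/

/-- (h) the frontier `x_f(t) = (2−t)^{1/N} e^{iπt/N}`, `t ∈ [0,1]` (`N ≥ 1`): `x_f ∈ S⁺`, `1/x_f ∈ S⁻`,
and the frontier identity `ε Y(x_f)/x_f = Y(1/x_f)`.  Registered auxiliary anchor of this stub file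
(the registered signature of `stub_sectorChart` carries line comments). [cite: Gross1978, §1] -/
theorem sectorChart_aux_frontier : ∀ {N : ℕ}, 1 ≤ N → ∀ t ∈ Set.Icc (0:ℝ) 1,
      0 ≤ ((((((2:ℝ) - t) ^ ((N:ℝ)⁻¹) : ℝ) : ℂ) * Complex.exp (↑Real.pi * Complex.I * (t : ℂ) / (N : ℂ))) ^ N).im ∧
      (((((((2:ℝ) - t) ^ ((N:ℝ)⁻¹) : ℝ) : ℂ) * Complex.exp (↑Real.pi * Complex.I * (t : ℂ) / (N : ℂ)))⁻¹) ^ N).im ≤ 0 ∧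
      ‖((((((2:ℝ) - t) ^ ((N:ℝ)⁻¹) : ℝ) : ℂ) * Complex.exp (↑Real.pi * Complex.I * (t : ℂ) / (N : ℂ)))⁻¹) ^ N‖ ≤ 1 ∧
      ((((((2:ℝ) - t) ^ ((N:ℝ)⁻¹) : ℝ) : ℂ) * Complex.exp (↑Real.pi * Complex.I * (t : ℂ) / (N : ℂ)))⁻¹) ^ N ≠ 1 ∧
      Complex.exp (↑Real.pi * Complex.I / (N : ℂ)) *
          (Complex.exp (-(↑Real.pi * Complex.I / (2 * (N : ℂ)))) *
            (Complex.I * (1 - (((((2:ℝ) - t) ^ ((N:ℝ)⁻¹) : ℝ) : ℂ) *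
              Complex.exp (↑Real.pi * Complex.I * (t : ℂ) / (N : ℂ))) ^ N)) ^ ((N : ℂ)⁻¹)) /
          (((((2:ℝ) - t) ^ ((N:ℝ)⁻¹) : ℝ) : ℂ) * Complex.exp (↑Real.pi * Complex.I * (t : ℂ) / (N : ℂ))) =
        Complex.exp (-(↑Real.pi * Complex.I / (2 * (N : ℂ)))) *
          (Complex.I * (1 - ((((((2:ℝ) - t) ^ ((N:ℝ)⁻¹) : ℝ) : ℂ) *
            Complex.exp (↑Real.pi * Complex.I * (t : ℂ) / (N : ℂ)))⁻¹) ^ N)) ^ ((N : ℂ)⁻¹) := by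
  intro N hN
  have hN0 : N ≠ 0 := by omega
  have hcont : Continuous (fun t : ℝ => ((((2:ℝ) - t) ^ ((N:ℝ)⁻¹) : ℝ) : ℂ) *
      Complex.exp (↑Real.pi * Complex.I * (t : ℂ) / (N : ℂ))) :=
    (Complex.continuous_ofReal.comp
      ((continuous_const.sub continuous_id).rpow_const fun t => Or.inr (by positivity))).mul
      (by fun_prop)
  have hne0 : ∀ t ∈ Set.Icc (0:ℝ) 1, ((((2:ℝ) - t) ^ ((N:ℝ)⁻¹) : ℝ) : ℂ) *
      Complex.exp (↑Real.pi * Complex.I * (t : ℂ) / (N : ℂ)) ≠ 0 := fun t ht =>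
    mul_ne_zero (Complex.ofReal_ne_zero.2 (Real.rpow_pos_of_pos (by linarith [ht.2]) _).ne')
      (Complex.exp_ne_zero _)
  have key := sectorChart_frontier_abstract hN0 (Complex.exp (↑Real.pi * Complex.I / (N : ℂ)))
    (sectorChart_eps_pow hN0)
    (fun z : ℂ => Complex.exp (-(↑Real.pi * Complex.I / (2 * (N : ℂ)))) * (Complex.I * (1 - z ^ N)) ^ ((N : ℂ)⁻¹))
    (sectorChart_pow hN0) (sectorChart_continuousOn_plus hN0) (sectorChart_continuousOn_minus hN0)
    (fun t : ℝ => ((((2:ℝ) - t) ^ ((N:ℝ)⁻¹) : ℝ) : ℂ) * Complex.exp (↑Real.pi * Complex.I * (t : ℂ) / (N : ℂ)))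
    hcont hne0 (sectorChart_frontier_mem hN0) (sectorChart_frontier_zero hN0)
  intro t ht
  obtain ⟨h1, h2, h3, h4⟩ := sectorChart_frontier_mem hN0 t ht
  exact ⟨h1, h2, h3, h4, key t ht⟩

/-! ## The stub -/

/-- SECTOR STUB B1 (the sector chart, analytic facts). For `N ≥ 3`: `Φ(z) = (z, Y z)` lies on `F_N`,
`Y(z) = exp(−iπ/(2N))·(i(1 − z^N))^{1/N}`; `Y` is continuous on `S⁺ = {0 ≤ Im z^N}` and on
`S⁻ = {Im u^N ≤ 0, |u^N| ≤ 1, u^N ≠ 1}` (the base `i(1 − z^N)` of the principal power stays off the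
closed negative real axis), both star-shaped at `0`; the values of `Y` on the real arc
`γ_N(t) = Q^{−1/N}(1−t, t)`, on the real branch `x > 1` (`Y(1/γ_x) = ε̄ γ_y/γ_x`), on the rays
`arg = ±π/N`, and the frontier identity `ε Y(x_f)/x_f = Y(1/x_f)` along `x_f(t) = (2−t)^{1/N}e^{iπt/N}`
(both sides are `N`-th roots of `1 − x_f^{−N}`, continuous in `t`, equal at `t = 0`); the chart
memberships of the sector paths' first coordinates. [cite: Gross1978, §1] -/
theorem stub_sectorChart : ∀ (N : ℕ), 3 ≤ N →
    -- (a) Φ(z) ∈ F_N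
    (∀ z : ℂ, (![z, Complex.exp (-(↑Real.pi * Complex.I / (2 * (N : ℂ)))) * (Complex.I * (1 - z ^ N)) ^ ((N : ℂ)⁻¹)] :
        Fin 2 → ℂ) ∈ (⟨2, 1, ![X 0 ^ N + X 1 ^ N - 1]⟩ : CurveData).points) ∧
    -- (b) continuity on S⁺ and star-convexity of S⁺
    ContinuousOn (fun z : ℂ => Complex.exp (-(↑Real.pi * Complex.I / (2 * (N : ℂ)))) * (Complex.I * (1 - z ^ N)) ^ ((N : ℂ)⁻¹))
      {z : ℂ | 0 ≤ (z ^ N).im} ∧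
    StarConvex ℝ (0 : ℂ) {z : ℂ | 0 ≤ (z ^ N).im} ∧
    -- (c) continuity on S⁻ and star-convexity of S⁻
    ContinuousOn (fun z : ℂ => Complex.exp (-(↑Real.pi * Complex.I / (2 * (N : ℂ)))) * (Complex.I * (1 - z ^ N)) ^ ((N : ℂ)⁻¹))
      {u : ℂ | (u ^ N).im ≤ 0 ∧ ‖u ^ N‖ ≤ 1 ∧ u ^ N ≠ 1} ∧
    StarConvex ℝ (0 : ℂ) {u : ℂ | (u ^ N).im ≤ 0 ∧ ‖u ^ N‖ ≤ 1 ∧ u ^ N ≠ 1} ∧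
    -- (d) the real arc: Y(γ_x(t)) = γ_y(t), and γ_x(t) ∈ S⁺; on the second half also γ_x ∈ S⁻
    (∀ t ∈ Set.Icc (0:ℝ) 1,
      Complex.exp (-(↑Real.pi * Complex.I / (2 * (N : ℂ)))) *
          (Complex.I * (1 - ((((1 - t) * ((1 - t) ^ N + t ^ N) ^ (-(1:ℝ) / N) : ℝ) : ℂ)) ^ N)) ^ ((N : ℂ)⁻¹) =
        ((t * ((1 - t) ^ N + t ^ N) ^ (-(1:ℝ) / N) : ℝ) : ℂ) ∧
      0 ≤ (((((1 - t) * ((1 - t) ^ N + t ^ N) ^ (-(1:ℝ) / N) : ℝ) : ℂ)) ^ N).im ∧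
      (1 / 2 ≤ t → (((((1 - t) * ((1 - t) ^ N + t ^ N) ^ (-(1:ℝ) / N) : ℝ) : ℂ)) ^ N).im ≤ 0 ∧
        ‖((((1 - t) * ((1 - t) ^ N + t ^ N) ^ (-(1:ℝ) / N) : ℝ) : ℂ)) ^ N‖ ≤ 1 ∧
        ((((1 - t) * ((1 - t) ^ N + t ^ N) ^ (-(1:ℝ) / N) : ℝ) : ℂ)) ^ N ≠ 1)) ∧
    -- (e) the branch x > 1 (path e₂ = g₂⁻¹ ∘ γ_N(t/2)): Y(1/γ_x(u)) = ε̄ γ_y(u)/γ_x(u) for u ∈ [0, 1/2], and 1/γ_x(u) ∈ S⁺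
    (∀ u ∈ Set.Icc (0:ℝ) (1/2),
      Complex.exp (-(↑Real.pi * Complex.I / (2 * (N : ℂ)))) *
          (Complex.I * (1 - (((((1 - u) * ((1 - u) ^ N + u ^ N) ^ (-(1:ℝ) / N) : ℝ) : ℂ))⁻¹) ^ N)) ^ ((N : ℂ)⁻¹) =
        Complex.exp (-(↑Real.pi * Complex.I / (N : ℂ))) * ((u * ((1 - u) ^ N + u ^ N) ^ (-(1:ℝ) / N) : ℝ) : ℂ) /
          ((((1 - u) * ((1 - u) ^ N + u ^ N) ^ (-(1:ℝ) / N) : ℝ) : ℂ)) ∧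
      0 ≤ (((((((1 - u) * ((1 - u) ^ N + u ^ N) ^ (-(1:ℝ) / N) : ℝ) : ℂ))⁻¹) ^ N).im)) ∧
    -- (f) the ray arg = π/N (path e₃ = g₃⁻¹ ∘ γ_N(v)): Y(ε γ_x(v)/γ_y(v)) = 1/γ_y(v) for v ∈ [1/2, 1], membership in S⁺
    (∀ v ∈ Set.Icc (1/2:ℝ) 1,
      Complex.exp (-(↑Real.pi * Complex.I / (2 * (N : ℂ)))) *
          (Complex.I * (1 - (Complex.exp (↑Real.pi * Complex.I / (N : ℂ)) *
            ((((1 - v) * ((1 - v) ^ N + v ^ N) ^ (-(1:ℝ) / N) : ℝ) : ℂ)) /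
            ((v * ((1 - v) ^ N + v ^ N) ^ (-(1:ℝ) / N) : ℝ) : ℂ)) ^ N)) ^ ((N : ℂ)⁻¹) =
        (((v * ((1 - v) ^ N + v ^ N) ^ (-(1:ℝ) / N) : ℝ) : ℂ))⁻¹ ∧
      0 ≤ ((Complex.exp (↑Real.pi * Complex.I / (N : ℂ)) *
            ((((1 - v) * ((1 - v) ^ N + v ^ N) ^ (-(1:ℝ) / N) : ℝ) : ℂ)) /
            ((v * ((1 - v) ^ N + v ^ N) ^ (-(1:ℝ) / N) : ℝ) : ℂ)) ^ N).im) ∧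
    -- (g) the ray arg = −π/N (path d₃ = g₂ ∘ g₃⁻¹ ∘ γ_N(u), near O): Y(ε̄ γ_y(u)/γ_x(u)) = 1/γ_x(u) for u ∈ [0, 1/2], membership in S⁻
    (∀ u ∈ Set.Icc (0:ℝ) (1/2),
      Complex.exp (-(↑Real.pi * Complex.I / (2 * (N : ℂ)))) *
          (Complex.I * (1 - (Complex.exp (-(↑Real.pi * Complex.I / (N : ℂ))) *
            ((u * ((1 - u) ^ N + u ^ N) ^ (-(1:ℝ) / N) : ℝ) : ℂ) /
            ((((1 - u) * ((1 - u) ^ N + u ^ N) ^ (-(1:ℝ) / N) : ℝ) : ℂ))) ^ N)) ^ ((N : ℂ)⁻¹) =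
        (((((1 - u) * ((1 - u) ^ N + u ^ N) ^ (-(1:ℝ) / N) : ℝ) : ℂ)))⁻¹ ∧
      ((Complex.exp (-(↑Real.pi * Complex.I / (N : ℂ))) *
            ((u * ((1 - u) ^ N + u ^ N) ^ (-(1:ℝ) / N) : ℝ) : ℂ) /
            ((((1 - u) * ((1 - u) ^ N + u ^ N) ^ (-(1:ℝ) / N) : ℝ) : ℂ))) ^ N).im ≤ 0 ∧
      ‖(Complex.exp (-(↑Real.pi * Complex.I / (N : ℂ))) *
            ((u * ((1 - u) ^ N + u ^ N) ^ (-(1:ℝ) / N) : ℝ) : ℂ) /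
            ((((1 - u) * ((1 - u) ^ N + u ^ N) ^ (-(1:ℝ) / N) : ℝ) : ℂ))) ^ N‖ ≤ 1 ∧
      (Complex.exp (-(↑Real.pi * Complex.I / (N : ℂ))) *
            ((u * ((1 - u) ^ N + u ^ N) ^ (-(1:ℝ) / N) : ℝ) : ℂ) /
            ((((1 - u) * ((1 - u) ^ N + u ^ N) ^ (-(1:ℝ) / N) : ℝ) : ℂ))) ^ N ≠ 1) ∧
    -- (h) the frontier x_f(t) = (2−t)^{1/N} e^{iπt/N}: x_f ∈ S⁺, 1/x_f ∈ S⁻, and ε Y(x_f)/x_f = Y(1/x_f)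
    (∀ t ∈ Set.Icc (0:ℝ) 1,
      0 ≤ ((((((2:ℝ) - t) ^ ((N:ℝ)⁻¹) : ℝ) : ℂ) * Complex.exp (↑Real.pi * Complex.I * (t : ℂ) / (N : ℂ))) ^ N).im ∧
      (((((((2:ℝ) - t) ^ ((N:ℝ)⁻¹) : ℝ) : ℂ) * Complex.exp (↑Real.pi * Complex.I * (t : ℂ) / (N : ℂ)))⁻¹) ^ N).im ≤ 0 ∧
      ‖((((((2:ℝ) - t) ^ ((N:ℝ)⁻¹) : ℝ) : ℂ) * Complex.exp (↑Real.pi * Complex.I * (t : ℂ) / (N : ℂ)))⁻¹) ^ N‖ ≤ 1 ∧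
      ((((((2:ℝ) - t) ^ ((N:ℝ)⁻¹) : ℝ) : ℂ) * Complex.exp (↑Real.pi * Complex.I * (t : ℂ) / (N : ℂ)))⁻¹) ^ N ≠ 1 ∧
      Complex.exp (↑Real.pi * Complex.I / (N : ℂ)) *
          (Complex.exp (-(↑Real.pi * Complex.I / (2 * (N : ℂ)))) *
            (Complex.I * (1 - (((((2:ℝ) - t) ^ ((N:ℝ)⁻¹) : ℝ) : ℂ) *
              Complex.exp (↑Real.pi * Complex.I * (t : ℂ) / (N : ℂ))) ^ N)) ^ ((N : ℂ)⁻¹)) /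
          (((((2:ℝ) - t) ^ ((N:ℝ)⁻¹) : ℝ) : ℂ) * Complex.exp (↑Real.pi * Complex.I * (t : ℂ) / (N : ℂ))) =
        Complex.exp (-(↑Real.pi * Complex.I / (2 * (N : ℂ)))) *
          (Complex.I * (1 - ((((((2:ℝ) - t) ^ ((N:ℝ)⁻¹) : ℝ) : ℂ) *
            Complex.exp (↑Real.pi * Complex.I * (t : ℂ) / (N : ℂ)))⁻¹) ^ N)) ^ ((N : ℂ)⁻¹)) := by
  intro N hN
  have hN0 : N ≠ 0 := by omega
  have hN1 : 1 ≤ N := by omega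
  exact ⟨sectorChart_mem_points hN0, sectorChart_continuousOn_plus hN0, sectorChart_starConvex_plus N,
    sectorChart_continuousOn_minus hN0, sectorChart_starConvex_minus N, sectorChart_arc hN1,
    sectorChart_branch hN1, sectorChart_rayPlus_arc hN1, sectorChart_rayMinus_arc hN1,
    sectorChart_aux_frontier hN1⟩

end Summit.KontsevichZagierPeriods.FermatIsogeny.BetaLinearSector

end
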